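import Literature.AlgebraicGeometry.Motives.HodgeStructureLefschetzGroupExteriorInvariants
import Literature.AlgebraicGeometry.Motives.HodgeStructureCentralizerGeneratedByLefschetzGroup
import HarnessLib

/-!
# Milne 1999, Prop. 3.3 and Thm. 3.2 ON `K`-POINTS, COVARIANT FORM: the `S(H)(K)`-invariant `2`-vectors of `⋀²(K ⊗ V)` are the
# `2`-vectors of the `†`-symmetric endomorphisms ("divisor classes"), and the `k`-algebra of `S(H)(K)`-invariants of `⋀(K ⊗ V)`
# is generated by them — "the `k`-algebra `H^*(A^r)^{S(A)}` is generated by divisor classes" (`r = 1`)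

[topic AlgebraicGeometry/Motives]

Layer `Literature/AlgebraicGeometry/Motives`, lane `lit-hodgefound` (Track 2 foundations library; seat `lit-hodgefound-p34`,
generation 25, self-proposed row g25-#3), namespaces `Literature.AlgebraicGeometry.Motives.ExteriorLefschetz` (§1, generic) and
`Literature.AlgebraicGeometry.Motives.HodgeStructure` (§2–§3). THEOREMS ONLY; no definition, no named fact, no `sorry` (D-0026,
net debt `0`).  Sequel of the seat's g25-#2 `Motives/HodgeStructureLefschetzGroupExteriorInvariants` (Prop. 3.4 on `K`-points:
`(⋀ W)^{S(H)(K)} = K[(⋀² W)^{S(H)(K)}]`) and g24-#5 `Motives/HodgeStructureCentralizerGeneratedByLefschetzGroup` (Prop. 3.3 on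
`K`-points for FORMS: the `S(H)(K)`-invariant skew forms on `W = K ⊗ V` are `span_K {(Q(a ·, ·))_K : a ∈ E_φ, a† = a}`).

## The source, verbatim

J. S. Milne, *Lefschetz classes on abelian varieties*, Duke Math. J. **96** (1999) 639–675 [`Milne1999LefschetzClasses`, held
`paper:doi-10-1215-s0012-7094-99-09620-5`; PDF page = printed page − 638], p. 653 (p0015 L24–L46): "**Theorem 3.2.** For any
abelian variety `A` over `Ω` and integer `r ≥ 0`, the `k`-algebra `H^*(A^r)^{S(A)}` is generated by divisor classes. […]
**Proposition 3.3.** […] the `k`-vector space `H²(A^r)^{S(A)}` is generated by divisor classes. […] **Proposition 3.4.** […]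
`H^*(A^r)^{S(A)} = k[H²(A^r)^{S(A)}]`. *Proof of Proposition 3.3.* […] We have to show that the space of skew-symmetric forms
`ψ : V(A) × V(A) → k(1)` invariant under the action of `S(A)` on `Hom(Λ²V(A), k(1))` is generated by the forms `e_D` with `D` a
divisor on `A`"; §1 p. 642: "`e_{D'} = e_D ∘ (α × 1)` for some `α ∈ End⁰(A)` with `α† = α` (Mumford 1970, p208)" — the divisor
classes are the forms `e_D(α ·, ·)`, `α† = α` (Mumford §21 Application III: `NS(A) ⊗ ℚ ≅ {α ∈ End⁰(A) | α† = α}`).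

## What is proved

`W = K ⊗_ℚ V` for a polarized `ℚ`-Hodge structure `(V, H, Q)` of ODD weight (so `Q_K` is alternating, non-degenerate) and a field
`K ⊇ ℚ`; `S(H)(K) = Polarization.lefschetzGroupBaseChange K Q` acts on `⋀ W` by `⋀(γ)`.  A `2`-vector `y ∈ ⋀² W` is read as the
skew form `ψ_y(v, w) = B_y(Q_K(v, ·), Q_K(w, ·))` on `W` (`B_y` = the contraction form of the abstract exterior files,
`ExteriorLefschetz.contractionForm`; `W ≅ W^∨` by `Q_K`).

* §1 (generic `(W, B)`, `B` non-degenerate; `ExteriorLefschetz`): `⋀(u) y = y ⟺ ψ_y` is `u`-invariant for an isometry `u` of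
  `B` (`map_eq_iff_forall_contractionForm_apply`), uniqueness (`eq_of_forall_contractionForm_apply_eq`) and — for `B` alternating,
  characteristic `0` — **existence of the `2`-vector of an alternating form**: every alternating `ψ` is `ψ_y` for a (unique)
  `y ∈ ⋀² W`, namely `y = −½ Σᵢ tᵢ ∧ bᵢ` with `B(tᵢ, ·) = ψ(bᵢ^B, ·)` (`exists_mem_exteriorPower_two_forall_contractionForm_apply_eq`).
* §2 **Prop. 3.3 on `K`-points, covariant, EVERY field `K ⊇ ℚ`**: `y ∈ ⋀² W` is `S(H)(K)`-invariant
  ⟺ `ψ_y ∈ span_K {(Q(a ·, ·))_K : a ∈ E_φ, a† = a}` (`Polarization.forall_lefschetzGroupBaseChange_map_eq_iff_mem_span`; g24-#5)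
  ⟺ `y` lies in the `K`-span of the DIVISOR `2`-VECTORS `y_a` (`a ∈ E_φ`, `a† = a`, `ψ_{y_a} = (Q(a ·, ·))_K`; they exist and are
  unique, `Polarization.exists_mem_exteriorPower_two_forall_contractionForm_apply_eq_baseChange`)
  (`Polarization.forall_lefschetzGroupBaseChange_map_eq_iff_mem_span_divisorTwoVectors`).
* §3 **Thm. 3.2 on `K`-points as printed (`r = 1`; `K` algebraically closed)**: every `S(H)(K)`-invariant `x ∈ ⋀^m W` — indeed
  every invariant element of `⋀ W` — is a polynomial in divisor `2`-vectors, and conversely: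
  `Polarization.setOf_forall_lefschetzGroupBaseChange_map_eq_eq_adjoin_divisorTwoVectors` ("the `k`-algebra `H^*(A)^{S(A)}` is
  generated by divisor classes"), from g25-#2 (Prop. 3.4) and §2 (Prop. 3.3).

NOT here: `r ≥ 2` (powers; Prop. 1.5 on `K`-points is the seat's g18-#5), descent of the statement to non-closed `K` (Lemma 3.1),
even weight, and the identification of the divisor `2`-vectors with `K ⊗ (Hodge classes of ⋀² H)` (Lefschetz (1,1) on the
abstract carrier — the p02 lineage `Motives/HodgeStructureExteriorPowerDivisorClasses`).

## References

* [Milne1999LefschetzClasses] J. S. Milne, Lefschetz classes on abelian varieties, Duke Math. J. 96 (1999) 639–675: §1 p. 642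
  (`e_D`, `α† = α`), p. 644 (`S(A)`), §3 Thm. 3.2, Prop. 3.3 and its proof, Prop. 3.4 (p. 653).
* [MumfordAV1970] D. Mumford, Abelian Varieties (1970), §20 Thm. 1, §21 Application III (p. 208).
* [BourbakiAlgebre1a3] N. Bourbaki, Algèbre, Ch. III §7 (`⋀(u)`), §11 no. 9 (interior products / the contraction form).
-/

noncomputable section

open scoped TensorProduct

namespace Literature.AlgebraicGeometry.Motives

/-! ### §1 Generic: `2`-vectors of `⋀² W` as forms on `W` through a non-degenerate `B` -/

namespace ExteriorLefschetz

open ExteriorAlgebra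

variable {K : Type*} [Field K] {W : Type*} [AddCommGroup W] [Module K W]

/-- **`⋀(u)` on `2`-vectors read through `B`**: for an isometry `u` of `B` and `y ∈ ⋀² W`,
`B_{⋀(u) y}(B(v,·), B(w,·)) = B_y(B(u⁻¹v,·), B(u⁻¹w,·))` (naturality of the contraction form, `contractionForm_map`, and
`B(v, u·) = B(u⁻¹ v, ·)`). [cite: BourbakiAlgebre1a3, Ch. III §7 no. 2 and §11 no. 9] -/
theorem contractionForm_map_apply_apply {B : LinearMap.BilinForm K W} {y : ExteriorAlgebra K W} (hy : y ∈ ⋀[K]^2 W)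
    (u : W ≃ₗ[K] W) (hu : ∀ v w, B (u v) (u w) = B v w) (v w : W) :
    contractionForm (ExteriorAlgebra.map (u : W →ₗ[K] W) y) (B v) (B w) =
      contractionForm y (B (u.symm v)) (B (u.symm w)) := by
  rw [contractionForm_map _ hy]
  have h : ∀ x, B x ∘ₗ (u : W →ₗ[K] W) = B (u.symm x) := fun x ↦ by
    ext z
    rw [LinearMap.comp_apply, LinearEquiv.coe_coe, ← hu (u.symm x) z, LinearEquiv.apply_symm_apply]
  rw [h, h]

/-- **`⋀(u) y = y` iff the form `ψ_y(v, w) = B_y(B(v,·), B(w,·))` is `u`-invariant** (`B` non-degenerate, characteristic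
`0`, `u` an isometry of `B`): a `2`-vector is its contraction form (`eq_of_contractionForm_eq`) and every functional is a
`B(v, ·)`. [cite: BourbakiAlgebre1a3, Ch. III §11 no. 9] [cite: Milne1999LefschetzClasses, §3 proof of Prop. 3.3 (p. 653)] -/
theorem map_eq_iff_forall_contractionForm_apply [CharZero K] [FiniteDimensional K W] {B : LinearMap.BilinForm K W}
    (hB : B.Nondegenerate) {y : ExteriorAlgebra K W} (hy : y ∈ ⋀[K]^2 W) (u : W ≃ₗ[K] W)
    (hu : ∀ v w, B (u v) (u w) = B v w) :
    ExteriorAlgebra.map (u : W →ₗ[K] W) y = y ↔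
      ∀ v w, contractionForm y (B (u v)) (B (u w)) = contractionForm y (B v) (B w) := by
  constructor
  · intro h v w
    have e := contractionForm_map_apply_apply hy u hu (u v) (u w)
    rw [h, LinearEquiv.symm_apply_apply, LinearEquiv.symm_apply_apply] at e
    exact e
  · intro h
    have hy' : ExteriorAlgebra.map (u : W →ₗ[K] W) y ∈ ⋀[K]^2 W := by
      have e := (exteriorPower.map 2 (u : W →ₗ[K] W) ⟨y, hy⟩).2
      rwa [coe_exteriorPower_map] at e
    refine eq_of_contractionForm_eq (isUnit_iff_ne_zero.2 two_ne_zero) hy' hy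
      (LinearMap.ext fun φ ↦ LinearMap.ext fun ψ ↦ ?_)
    obtain ⟨v, rfl⟩ := exists_eq_apply hB φ
    obtain ⟨w, rfl⟩ := exists_eq_apply hB ψ
    rw [contractionForm_map_apply_apply hy u hu, ← h (u.symm v) (u.symm w), LinearEquiv.apply_symm_apply,
      LinearEquiv.apply_symm_apply]

/-- **A `2`-vector is determined by its form `ψ_y`** (`B` non-degenerate, characteristic `0`).
[cite: BourbakiAlgebre1a3, Ch. III §11 no. 9] -/
theorem eq_of_forall_contractionForm_apply_eq [CharZero K] [FiniteDimensional K W] {B : LinearMap.BilinForm K W}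
    (hB : B.Nondegenerate) {y y' : ExteriorAlgebra K W} (hy : y ∈ ⋀[K]^2 W) (hy' : y' ∈ ⋀[K]^2 W)
    (h : ∀ v w, contractionForm y (B v) (B w) = contractionForm y' (B v) (B w)) : y = y' :=
  eq_of_contractionForm_eq (isUnit_iff_ne_zero.2 two_ne_zero) hy hy' (LinearMap.ext fun φ ↦ LinearMap.ext fun ψ ↦ by
    obtain ⟨v, rfl⟩ := exists_eq_apply hB φ
    obtain ⟨w, rfl⟩ := exists_eq_apply hB ψ
    exact h v w)

/-- A wedge `t ∧ b` lies in `⋀² W`. [cite: BourbakiAlgebre1a3, Ch. III §7 no. 1] -/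
theorem ι_mul_ι_mem_exteriorPower_two (t b : W) : ι K t * ι K b ∈ ⋀[K]^2 W := by
  rw [exteriorPower, pow_two]
  exact Submodule.mul_mem_mul (LinearMap.mem_range_self _ _) (LinearMap.mem_range_self _ _)

/-- **The `2`-vector of an alternating form** (`B` non-degenerate alternating, characteristic `0`): every alternating bilinear
form `ψ` on `W` is `ψ_y` for some `y ∈ ⋀² W` — explicitly `y = −½ Σᵢ tᵢ ∧ bᵢ` for a basis `bᵢ`, its `B`-dual basis `bᵢ^B`
(`x = Σᵢ B(x, bᵢ) bᵢ^B`) and `B(tᵢ, ·) = ψ(bᵢ^B, ·)`: `B_y(B(v,·), B(w,·)) = −½ Σᵢ (B(v,bᵢ)B(w,tᵢ) − B(v,tᵢ)B(w,bᵢ))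
= −½ (−ψ(v,w) − ψ(v,w))`.  Together with `eq_of_forall_contractionForm_apply_eq`: `y ↦ ψ_y` is a bijection `⋀² W ≅ Alt²(W)`
(the covariant reading `Hom(Λ²V(A), k) ≅ ⋀² H¹` of the proof of Prop. 3.3). [cite: BourbakiAlgebre1a3, Ch. III §11 no. 9]
[cite: Milne1999LefschetzClasses, §3 proof of Prop. 3.3 (p. 653)] -/
theorem exists_mem_exteriorPower_two_forall_contractionForm_apply_eq [CharZero K] [FiniteDimensional K W]
    {B : LinearMap.BilinForm K W} (hB : B.Nondegenerate) (hBa : B.IsAlt) (ψ : LinearMap.BilinForm K W) (hψ : ψ.IsAlt) :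
    ∃ y ∈ ⋀[K]^2 W, ∀ v w, contractionForm y (B v) (B w) = ψ v w := by
  classical
  set b := Module.finBasis K W with hb
  set d := B.dualBasis hB b with hd
  have ht' : ∀ i, ∃ t : W, B t = ψ (d i) := fun i ↦ exists_eq_apply hB (ψ (d i))
  choose t ht using ht'
  have ht₂ : ∀ i x, B (t i) x = ψ (d i) x := fun i x ↦ by rw [ht i]
  refine ⟨(-(2 : K)⁻¹) • ∑ i, ι K (t i) * ι K (b i),
    Submodule.smul_mem _ _ (Submodule.sum_mem _ fun i _ ↦ ι_mul_ι_mem_exteriorPower_two (t i) (b i)), fun v w ↦ ?_⟩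
  -- the expansion `ψ(x, z) = Σᵢ B(x, bᵢ) ψ(bᵢ^B, z)`
  have hexp : ∀ x z, ψ x z = ∑ i, B x (b i) * ψ (d i) z := fun x z ↦ by
    conv_lhs => rw [← sum_apply_smul_dualBasis hB b x]
    rw [map_sum, LinearMap.sum_apply]
    simp_rw [map_smul, LinearMap.smul_apply, smul_eq_mul]
    rfl
  have e1 : ∑ i, B v (b i) * B w (t i) = -ψ v w := by
    rw [hexp v w, ← Finset.sum_neg_distrib]
    refine Finset.sum_congr rfl fun i _ ↦ ?_
    rw [← hBa.neg_eq (t i) w, ht₂ i w]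
    ring
  have e2 : ∑ i, B v (t i) * B w (b i) = ψ v w := by
    rw [← hψ.neg_eq w v, hexp w v, ← Finset.sum_neg_distrib]
    refine Finset.sum_congr rfl fun i _ ↦ ?_
    rw [← hBa.neg_eq (t i) v, ht₂ i v]
    ring
  rw [contractionForm_smul, LinearMap.smul_apply, LinearMap.smul_apply, contractionForm_sum]
  simp_rw [contractionForm_ι_mul_ι]
  rw [Finset.sum_sub_distrib, e1, e2, smul_eq_mul]
  have h2 : (2 : K) ≠ 0 := two_ne_zero
  field_simp
  ring

end ExteriorLefschetz

/-! ### §2 Prop. 3.3 on `K`-points, covariant: the `S(H)(K)`-invariant `2`-vectors are the divisor `2`-vectors -/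

namespace HodgeStructure

open ExteriorLefschetz

universe u uK

variable (K : Type uK) [Field K] [Algebra ℚ K] {V : Type u} [AddCommGroup V] [Module ℚ V] [Module.Finite ℚ V] {n : ℤ}
  {H : HodgeStructure V n} (Q : Polarization H)

/-- **Prop. 3.3 (`r = 1`) on `K`-points, covariant form, for EVERY field `K ⊇ ℚ` and odd weight**: a `2`-vector
`y ∈ ⋀²(K ⊗ V)` is fixed by `⋀(γ)` for every `γ ∈ S(H)(K)` iff its skew form `ψ_y = B_y(Q_K(·,·), Q_K(·,·))` lies in
`span_K {(Q(a ·, ·))_K : a ∈ E_φ, a† = a}` — "the space of skew-symmetric forms […] invariant under the action of `S(A)` on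
`Hom(Λ²V(A), k(1))` is generated by the forms `e_D`", read on `⋀²` through `V(A) ≅ V(A)^∨` (the seat's g24-#5
`Polarization.forall_lefschetzGroupBaseChange_form_apply_apply_and_swap_iff_mem_span` + §1).
[cite: Milne1999LefschetzClasses, §3 Prop. 3.3 and its proof (p. 653 L28–L46), §1 p. 642] [cite: MumfordAV1970, §21 Application III p. 208] -/
theorem Polarization.forall_lefschetzGroupBaseChange_map_eq_iff_mem_span (hn : Odd n) {y : ExteriorAlgebra K (K ⊗[ℚ] V)}
    (hy : y ∈ ⋀[K]^2 (K ⊗[ℚ] V)) :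
    (∀ γ ∈ Q.lefschetzGroupBaseChange K, ExteriorAlgebra.map (γ : (K ⊗[ℚ] V) →ₗ[K] (K ⊗[ℚ] V)) y = y) ↔
      (contractionForm y).compl₁₂ (Q.form.baseChange K) (Q.form.baseChange K) ∈
        Submodule.span K ((fun a : Module.End ℚ V ↦ LinearMap.BilinForm.baseChange K (Q.form ∘ₗ a)) ''
          {a | a ∈ H.endAlg ∧ Q.adjoint a = a}) := by
  haveI : CharZero K := charZero_of_injective_algebraMap (algebraMap ℚ K).injective
  rw [← Q.forall_lefschetzGroupBaseChange_form_apply_apply_and_swap_iff_mem_span K]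
  have hskew : ∀ x z : K ⊗[ℚ] V,
      (contractionForm y).compl₁₂ (Q.form.baseChange K) (Q.form.baseChange K) z x =
        (((n.negOnePow : ℤˣ) : ℤ) : K) * (contractionForm y).compl₁₂ (Q.form.baseChange K) (Q.form.baseChange K) x z := by
    intro x z
    rw [Int.negOnePow_odd n hn, Units.val_neg, Units.val_one, Int.cast_neg, Int.cast_one, neg_one_mul,
      LinearMap.compl₁₂_apply, LinearMap.compl₁₂_apply,
      ← (contractionForm_isAlt y).neg_eq (Q.form.baseChange K x) (Q.form.baseChange K z)]
  have hB := Q.baseChange_form_nondegenerate K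
  constructor
  · intro h
    refine ⟨fun γ hγ x z ↦ ?_, hskew⟩
    rw [LinearMap.compl₁₂_apply, LinearMap.compl₁₂_apply]
    exact (map_eq_iff_forall_contractionForm_apply hB hy γ
      (Q.baseChange_form_apply_apply_of_mem_lefschetzGroupBaseChange hγ)).1 (h γ hγ) x z
  · rintro ⟨h, -⟩ γ hγ
    refine (map_eq_iff_forall_contractionForm_apply hB hy γ
      (Q.baseChange_form_apply_apply_of_mem_lefschetzGroupBaseChange hγ)).2 fun v w ↦ ?_
    have e := h γ hγ v w
    rwa [LinearMap.compl₁₂_apply, LinearMap.compl₁₂_apply] at e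

/-- **The divisor `2`-vectors exist and are unique**: for odd weight and `a ∈ E_φ` with `a† = a` (a "divisor class"
`e_D(α ·, ·)`, Mumford's `NS(A) ⊗ ℚ ≅ {α | α† = α}`), there is exactly one `y_a ∈ ⋀²(K ⊗ V)` whose form `ψ_{y_a}` is
`(Q(a ·, ·))_K` — over EVERY field `K ⊇ ℚ`; and `y_a` is `S(H)(K)`-invariant.
[cite: Milne1999LefschetzClasses, §1 p. 642 L68–L74 and §3 Prop. 3.3 (p. 653)] [cite: MumfordAV1970, §21 Application III p. 208] -/
theorem Polarization.exists_mem_exteriorPower_two_forall_contractionForm_apply_eq_baseChange (hn : Odd n)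
    {a : Module.End ℚ V} (ha : a ∈ H.endAlg) (ha' : Q.adjoint a = a) :
    ∃ y ∈ ⋀[K]^2 (K ⊗[ℚ] V),
      (∀ v w, contractionForm y (Q.form.baseChange K v) (Q.form.baseChange K w) = LinearMap.BilinForm.baseChange K (Q.form ∘ₗ a) v w) ∧
      (∀ γ ∈ Q.lefschetzGroupBaseChange K, ExteriorAlgebra.map (γ : (K ⊗[ℚ] V) →ₗ[K] (K ⊗[ℚ] V)) y = y) ∧
      ∀ y' ∈ ⋀[K]^2 (K ⊗[ℚ] V),
        (∀ v w, contractionForm y' (Q.form.baseChange K v) (Q.form.baseChange K w) = LinearMap.BilinForm.baseChange K (Q.form ∘ₗ a) v w) →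
          y' = y := by
  haveI : CharZero K := charZero_of_injective_algebraMap (algebraMap ℚ K).injective
  have hB := Q.baseChange_form_nondegenerate K
  -- the form `(Q(a ·, ·))_K` is in Milne's span, hence `S(H)(K)`-invariant and skew, hence alternating
  have hmem : LinearMap.BilinForm.baseChange K (Q.form ∘ₗ a) ∈ Submodule.span K ((fun a : Module.End ℚ V ↦
      LinearMap.BilinForm.baseChange K (Q.form ∘ₗ a)) '' {a | a ∈ H.endAlg ∧ Q.adjoint a = a}) :=
    Submodule.subset_span ⟨a, ⟨ha, ha'⟩, rfl⟩
  have hsk := ((Q.forall_lefschetzGroupBaseChange_form_apply_apply_and_swap_iff_mem_span K _).2 hmem).2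
  have halt : (LinearMap.BilinForm.baseChange K (Q.form ∘ₗ a)).IsAlt := by
    intro x
    have h := hsk x x
    rw [Int.negOnePow_odd n hn, Units.val_neg, Units.val_one, Int.cast_neg, Int.cast_one, neg_one_mul] at h
    have h2 : (2 : K) * LinearMap.BilinForm.baseChange K (Q.form ∘ₗ a) x x = 0 := by
      rw [two_mul]
      nth_rewrite 1 [h]
      exact neg_add_cancel _
    exact (mul_eq_zero.1 h2).resolve_left two_ne_zero
  obtain ⟨y, hy, hyψ⟩ := exists_mem_exteriorPower_two_forall_contractionForm_apply_eq hB
    (Q.baseChange_form_isAlt_of_odd K hn) _ halt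
  refine ⟨y, hy, hyψ, ?_, fun y' hy' hy'ψ ↦ eq_of_forall_contractionForm_apply_eq hB hy' hy fun v w ↦ by
    rw [hyψ, hy'ψ]⟩
  refine (Q.forall_lefschetzGroupBaseChange_map_eq_iff_mem_span K hn hy).2 ?_
  have heq : (contractionForm y).compl₁₂ (Q.form.baseChange K) (Q.form.baseChange K) = LinearMap.BilinForm.baseChange K (Q.form ∘ₗ a) :=
    LinearMap.ext fun v ↦ LinearMap.ext fun w ↦ by rw [LinearMap.compl₁₂_apply, hyψ]
  rw [heq]
  exact hmem

/-- **Prop. 3.3 (`r = 1`) on `K`-points, covariant, in terms of `2`-vectors, EVERY field `K ⊇ ℚ`, odd weight**: a `2`-vector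
`y ∈ ⋀²(K ⊗ V)` is `S(H)(K)`-invariant iff it lies in the `K`-span of the divisor `2`-vectors (the `y' ∈ ⋀²` whose form
`ψ_{y'}` is `(Q(a ·, ·))_K` for some `a ∈ E_φ` with `a† = a`) — "the `k`-vector space `H²(A^r)^{S(A)}` is generated by divisor
classes". [cite: Milne1999LefschetzClasses, §3 Prop. 3.3 (p. 653)] [cite: MumfordAV1970, §21 Application III p. 208] -/
theorem Polarization.forall_lefschetzGroupBaseChange_map_eq_iff_mem_span_divisorTwoVectors (hn : Odd n)
    {y : ExteriorAlgebra K (K ⊗[ℚ] V)} (hy : y ∈ ⋀[K]^2 (K ⊗[ℚ] V)) :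
    (∀ γ ∈ Q.lefschetzGroupBaseChange K, ExteriorAlgebra.map (γ : (K ⊗[ℚ] V) →ₗ[K] (K ⊗[ℚ] V)) y = y) ↔
      y ∈ Submodule.span K {y' : ExteriorAlgebra K (K ⊗[ℚ] V) | y' ∈ ⋀[K]^2 (K ⊗[ℚ] V) ∧ ∃ a ∈ H.endAlg, Q.adjoint a = a ∧
        ∀ v w, contractionForm y' (Q.form.baseChange K v) (Q.form.baseChange K w) = LinearMap.BilinForm.baseChange K (Q.form ∘ₗ a) v w} := by
  haveI : CharZero K := charZero_of_injective_algebraMap (algebraMap ℚ K).injective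
  have hB := Q.baseChange_form_nondegenerate K
  constructor
  · intro h
    have hψ := (Q.forall_lefschetzGroupBaseChange_map_eq_iff_mem_span K hn hy).1 h
    -- lift the membership of `ψ_y` in the span of the forms to a `2`-vector in the span of the divisor 2-vectors
    suffices hmain : ∀ φ ∈ Submodule.span K ((fun a : Module.End ℚ V ↦ LinearMap.BilinForm.baseChange K (Q.form ∘ₗ a)) ''
        {a | a ∈ H.endAlg ∧ Q.adjoint a = a}),
        ∃ z ∈ Submodule.span K {y' : ExteriorAlgebra K (K ⊗[ℚ] V) | y' ∈ ⋀[K]^2 (K ⊗[ℚ] V) ∧ ∃ a ∈ H.endAlg,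
          Q.adjoint a = a ∧ ∀ v w, contractionForm y' (Q.form.baseChange K v) (Q.form.baseChange K w) =
            LinearMap.BilinForm.baseChange K (Q.form ∘ₗ a) v w},
          z ∈ ⋀[K]^2 (K ⊗[ℚ] V) ∧ ∀ v w, contractionForm z (Q.form.baseChange K v) (Q.form.baseChange K w) = φ v w by
      obtain ⟨z, hz, hz2, hzφ⟩ := hmain _ hψ
      have hyz : y = z := eq_of_forall_contractionForm_apply_eq hB hy hz2 fun v w ↦ by
        rw [hzφ, LinearMap.compl₁₂_apply]
      rw [hyz]
      exact hz
    intro φ hφ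
    induction hφ using Submodule.span_induction with
    | mem φ hφ =>
      obtain ⟨a, ⟨ha, ha'⟩, rfl⟩ := hφ
      obtain ⟨ya, hya, hyaψ, -, -⟩ :=
        Q.exists_mem_exteriorPower_two_forall_contractionForm_apply_eq_baseChange K hn ha ha'
      exact ⟨ya, Submodule.subset_span ⟨hya, a, ha, ha', hyaψ⟩, hya, hyaψ⟩
    | zero => exact ⟨0, Submodule.zero_mem _, Submodule.zero_mem _, fun v w ↦ by simp [contractionForm_apply]⟩
    | add φ φ' _ _ hφ hφ' =>
      obtain ⟨z, hz, hz2, hzφ⟩ := hφ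
      obtain ⟨z', hz', hz'2, hz'φ⟩ := hφ'
      exact ⟨z + z', Submodule.add_mem _ hz hz', Submodule.add_mem _ hz2 hz'2, fun v w ↦ by
        rw [contractionForm_add, LinearMap.add_apply, LinearMap.add_apply, hzφ, hz'φ, LinearMap.add_apply,
          LinearMap.add_apply]⟩
    | smul c φ _ hφ =>
      obtain ⟨z, hz, hz2, hzφ⟩ := hφ
      exact ⟨c • z, Submodule.smul_mem _ c hz, Submodule.smul_mem _ c hz2, fun v w ↦ by
        rw [contractionForm_smul, LinearMap.smul_apply, LinearMap.smul_apply, hzφ, LinearMap.smul_apply,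
          LinearMap.smul_apply]⟩
  · intro h γ hγ
    clear hy
    induction h using Submodule.span_induction with
    | mem y' hy' =>
      obtain ⟨hy'2, a, ha, ha', hy'ψ⟩ := hy'
      obtain ⟨ya, -, -, hinv, huniq⟩ :=
        Q.exists_mem_exteriorPower_two_forall_contractionForm_apply_eq_baseChange K hn ha ha'
      rw [huniq y' hy'2 hy'ψ]
      exact hinv γ hγ
    | zero => rw [map_zero]
    | add y₁ y₂ _ _ h₁ h₂ => rw [map_add, h₁, h₂]
    | smul c y₁ _ h₁ => rw [map_smul, h₁]

/-! ### §3 Thm. 3.2 on `K`-points: the `S(H)(K)`-invariants of `⋀(K ⊗ V)` are generated by the divisor `2`-vectors -/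

set_option maxSynthPendingDepth 4 in
/-- **Milne 1999, Thm. 3.2 (`r = 1`) on `K`-points, as printed: "the `k`-algebra `H^*(A^r)^{S(A)}` is generated by divisor
classes"** — for a polarized `ℚ`-Hodge structure of odd weight and `K ⊇ ℚ` algebraically closed, the set of
`S(H)(K)`-invariant elements of the exterior algebra `⋀(K ⊗ V)` IS the `K`-subalgebra generated by the divisor `2`-vectors
`y_a` (`a ∈ E_φ`, `a† = a`): Prop. 3.4 on `K`-points (the seat's g25-#2
`Polarization.setOf_forall_lefschetzGroupBaseChange_map_eq_eq_adjoin`) and Prop. 3.3 (§2).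
[cite: Milne1999LefschetzClasses, Thm. 3.2, Prop. 3.3, Prop. 3.4 (p. 653)] [cite: MumfordAV1970, §21 Application III p. 208] -/
theorem Polarization.setOf_forall_lefschetzGroupBaseChange_map_eq_eq_adjoin_divisorTwoVectors [IsAlgClosed K] (hn : Odd n) :
    {x : ExteriorAlgebra K (K ⊗[ℚ] V) |
        ∀ γ ∈ Q.lefschetzGroupBaseChange K, ExteriorAlgebra.map (γ : (K ⊗[ℚ] V) →ₗ[K] (K ⊗[ℚ] V)) x = x} =
      Algebra.adjoin K {y' : ExteriorAlgebra K (K ⊗[ℚ] V) | y' ∈ ⋀[K]^2 (K ⊗[ℚ] V) ∧ ∃ a ∈ H.endAlg, Q.adjoint a = a ∧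
        ∀ v w, contractionForm y' (Q.form.baseChange K v) (Q.form.baseChange K w) = LinearMap.BilinForm.baseChange K (Q.form ∘ₗ a) v w} := by
  rw [Q.setOf_forall_lefschetzGroupBaseChange_map_eq_eq_adjoin K hn]
  refine SetLike.coe_injective.eq_iff.2 (le_antisymm (Algebra.adjoin_le fun y hy ↦ ?_) (Algebra.adjoin_mono fun y' hy' ↦ ?_))
  · exact Algebra.span_le_adjoin K _
      ((Q.forall_lefschetzGroupBaseChange_map_eq_iff_mem_span_divisorTwoVectors K hn hy.1).1 hy.2)
  · obtain ⟨hy'2, a, ha, ha', hy'ψ⟩ := hy'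
    obtain ⟨ya, -, -, hinv, huniq⟩ :=
      Q.exists_mem_exteriorPower_two_forall_contractionForm_apply_eq_baseChange K hn ha ha'
    exact ⟨hy'2, fun γ hγ ↦ by rw [huniq y' hy'2 hy'ψ]; exact hinv γ hγ⟩

set_option maxSynthPendingDepth 4 in
/-- **Thm. 3.2 on `K`-points, membership form**: every `S(H)(K)`-invariant element of `⋀(K ⊗ V)` (odd weight, `K`
algebraically closed; in particular every invariant `x ∈ ⋀^m(K ⊗ V)`) is a polynomial in the divisor `2`-vectors.
[cite: Milne1999LefschetzClasses, Thm. 3.2 (p. 653)] -/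
theorem Polarization.mem_adjoin_divisorTwoVectors_of_forall_lefschetzGroupBaseChange_map_eq [IsAlgClosed K] (hn : Odd n)
    {x : ExteriorAlgebra K (K ⊗[ℚ] V)}
    (hx : ∀ γ ∈ Q.lefschetzGroupBaseChange K, ExteriorAlgebra.map (γ : (K ⊗[ℚ] V) →ₗ[K] (K ⊗[ℚ] V)) x = x) :
    x ∈ Algebra.adjoin K {y' : ExteriorAlgebra K (K ⊗[ℚ] V) | y' ∈ ⋀[K]^2 (K ⊗[ℚ] V) ∧ ∃ a ∈ H.endAlg, Q.adjoint a = a ∧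
      ∀ v w, contractionForm y' (Q.form.baseChange K v) (Q.form.baseChange K w) = LinearMap.BilinForm.baseChange K (Q.form ∘ₗ a) v w} := by
  have h : x ∈ {x : ExteriorAlgebra K (K ⊗[ℚ] V) |
      ∀ γ ∈ Q.lefschetzGroupBaseChange K, ExteriorAlgebra.map (γ : (K ⊗[ℚ] V) →ₗ[K] (K ⊗[ℚ] V)) x = x} := hx
  rw [Q.setOf_forall_lefschetzGroupBaseChange_map_eq_eq_adjoin_divisorTwoVectors K hn] at h
  exact h

end HodgeStructure

end Literature.AlgebraicGeometry.Motives

end
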